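import Summits.BirchSwinnertonDyer.BirchSwinnertonDyer.Theorems.BiquadraticEisensteinDescentHeegnerFieldSupplyOddRung
import HarnessLib

/-!
# Route BiquadraticEisensteinDescent — KS rung, UNBOUNDED form: the class-number half of
# `HeegnerFieldSupplyCMInertBadAdm` (item stmt-BirchSwinnertonDyer-20198) for ODD conductor with
# `|d_K′|` as large as desired (the `∀ B` shape of the registered stub `stub_KS1`, twist clause apart)

Companion of `…HeegnerFieldSupplyOddRung.lean` (prover seat bsd-wall-bed-p2 g5: ONE Heegner field
`K′` with `|d_K′| > 4` and `p ∤ h(K′)` for odd `N_W`, granted Beckwith–Raum–Richter 2024 Thm 1 BY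
NAME). The registered bridge stub `stub_KS1` of the crux KS asks for such fields with `|d_K′| > B`
for EVERY bound `B` (and, in addition, `L(W^(d_K′),1) ≠ 0` — the twist clause, NOT addressed here).
This file supplies the unbounded class-number half:

* `odd_oddPrimesUpTo`, `dvd_oddPrimesUpTo` — bookkeeping for the auxiliary odd level
  `∏_{ℓ ≤ B, ℓ odd prime} ℓ` (written out as a `Finset.prod`, no definition) fed to Thm 1 as `S₊`;
* **`lt_natAbs_discr_of_satisfiesHeegnerHypothesis_oddPrimesUpTo`** — if `K` is imaginary quadratic
  and every odd prime `ℓ ≤ max B 5` splits in `K`, then `B < |d_K|`: a split prime does not divide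
  `d_K`, so `|d_K| ≤ B` would leave `|d_K| = 2^k`; but `3` split forces `(−2^k/3) = 1`, i.e. `k`
  odd, and `5` split forces `(−2^k/5) = 1`, i.e. `k` even — no appeal to the shape of fundamental
  discriminants;
* `exists_heegnerField_lt_natAbs_discr_not_dvd_classNumber` — GRANTED BRR24 Thm 1 (antecedent, the
  tree's named fact): for every prime `ℓ`, every ODD `N` and every `B` there is an imaginary
  quadratic `K` with `B < |d_K|`, `4 < |d_K|`, the Heegner hypothesis for `N` and `ℓ ∤ h_K`
  (Thm 1 with `S₊ = primeFactors (21 · N · ∏_{ℓ' ≤ max B 5, ℓ' odd prime} ℓ')`, all odd);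
* `ksRung_oddConductor_unbounded` — the same in the binders of KS / `stub_KS1`: for `W` CM of
  analytic rank `1`, `p ≥ 5` inert-bad, `N_W` odd and every `B`: `∃ K′` imaginary quadratic with
  `B < |d_K′|`, `4 < |d_K′|`, `SatisfiesHeegnerHypothesis N_W K′`, `p ∤ h(K′)` — i.e. the
  registered signature of `stub_KS1` with the conjunct `L(W^(d_K′),1) ≠ 0` removed and the two
  antecedents `BRR24 Thm 1`, `Odd N_W` added.

HONEST FRAMING: THEOREMS ONLY (0 definitions, 0 named facts, 0 `sorry`); every supply statement is an
IMPLICATION from the published input BRR24 Thm 1 (`def … : Prop`, unproved in the tree). NOT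
covered, and said so: EVEN `N_W` (Thm 1, Wiles 2015 Thm 0.0.1 and Beckwith 2017 Thm 1.1 all
prescribe ODD split primes only — the splitting of `2` required by the Heegner hypothesis of an even
conductor is not supplied in print), the twist non-vanishing conjunct (the crux's open coupling),
and the biquadratic class number. Helper `--supports` KS; it closes nothing.
Prover seat bsd-wall-bed-p3 (g1), 2026-08-27.

References: [BeckwithRaumRichter2024] IMRN 2024:16, 11582–11596, Theorem 1; [Beckwith2017]
O. Beckwith, Res. Math. Sci. 4 (2017), Thm. 1.1 (arXiv:1612.04443 p. 4: odd `S`); [Marcus2018]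
Ch. 3 Thm. 25 (decomposition law); [IrelandRosen1990] Prop. 5.1.2 (Jacobi symbol).
-/

set_option autoImplicit false

-- D-0017 layout: summit = sub-problem, so `Summit.BirchSwinnertonDyer.BirchSwinnertonDyer.…` is the mandated namespace.
set_option linter.dupNamespace false

open scoped NumberField
open Literature.NumberTheory.EllipticCurves Literature.NumberTheory.QuadraticFields

namespace Summit.BirchSwinnertonDyer.BirchSwinnertonDyer.Theorems.BiquadraticEisensteinDescentHeegnerFieldSupplyOddRungUnbounded

open Summit.BirchSwinnertonDyer.BirchSwinnertonDyer.Theorems.BiquadraticEisensteinDescentHeegnerFieldSupplyOddRung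

/-! ### §1. The auxiliary odd level `∏_{ℓ ≤ B, ℓ odd prime} ℓ` -/

/-- `∏_{ℓ ≤ B, ℓ odd prime} ℓ` is odd. [folklore] -/
theorem odd_oddPrimesUpTo (B : ℕ) :
    Odd (∏ q ∈ (Finset.range (B + 1)).filter (fun q => q.Prime ∧ q ≠ 2), q) := by
  apply Finset.prod_induction _ Odd (fun a b ha hb => ha.mul hb) odd_one
  intro q hq
  rw [Finset.mem_filter] at hq
  exact hq.2.1.odd_of_ne_two hq.2.2

/-- Every odd prime `ℓ ≤ B` divides `∏_{ℓ ≤ B, ℓ odd prime} ℓ`. [folklore] -/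
theorem dvd_oddPrimesUpTo {B ℓ : ℕ} (hℓ : ℓ.Prime) (hℓ2 : ℓ ≠ 2) (hℓB : ℓ ≤ B) :
    ℓ ∣ (∏ q ∈ (Finset.range (B + 1)).filter (fun q => q.Prime ∧ q ≠ 2), q) := by
  apply Finset.dvd_prod_of_mem
  rw [Finset.mem_filter, Finset.mem_range]
  exact ⟨Nat.lt_succ_of_le hℓB, hℓ, hℓ2⟩

/-! ### §2. Splitting of all small odd primes forces a large discriminant -/

/-- `(−2^k / 3) = 1` forces `k` odd: `(−1/3) = (2/3) = −1`. [cite: IrelandRosen1990, Prop. 5.1.2] -/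
theorem odd_of_jacobiSym_neg_two_pow_three {k : ℕ} (h : jacobiSym (-(2 : ℤ) ^ k) 3 = 1) : Odd k := by
  rw [neg_eq_neg_one_mul, jacobiSym.mul_left, jacobiSym.pow_left] at h
  have h1 : jacobiSym (-1) 3 = -1 := by norm_num
  have h2 : jacobiSym 2 3 = -1 := by norm_num
  rw [h1, h2, ← pow_succ'] at h
  have hev : Even (k + 1) := (neg_one_pow_eq_one_iff_even (by norm_num)).mp h
  rcases Nat.even_or_odd k with hk | hk
  · exact absurd hev (Nat.not_even_iff_odd.mpr (hk.add_one))
  · exact hk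

/-- `(−2^k / 5) = 1` forces `k` even: `(−1/5) = 1`, `(2/5) = −1`. [cite: IrelandRosen1990, Prop. 5.1.2] -/
theorem even_of_jacobiSym_neg_two_pow_five {k : ℕ} (h : jacobiSym (-(2 : ℤ) ^ k) 5 = 1) : Even k := by
  rw [neg_eq_neg_one_mul, jacobiSym.mul_left, jacobiSym.pow_left] at h
  have h1 : jacobiSym (-1) 5 = 1 := by norm_num
  have h2 : jacobiSym 2 5 = -1 := by norm_num
  rw [h1, h2, one_mul] at h
  exact (neg_one_pow_eq_one_iff_even (by norm_num)).mp h

/-- **Splitting of every odd prime `≤ max B 5` forces `B < |d_K|`.** For an imaginary quadratic `K`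
satisfying the Heegner hypothesis for `∏_{ℓ ≤ max B 5, ℓ odd prime} ℓ` (every such `ℓ` splits):
a split prime does not divide `d_K` (`SatisfiesHeegnerHypothesis.not_dvd_discr`), so if `|d_K| ≤ B`
then `|d_K|` has no odd prime factor, `|d_K| = 2^k`; and `3`, `5` split give `(−2^k/3) = 1 =
(−2^k/5)` (`….jacobiSym_discr_eq_one`), i.e. `k` odd and even at once. [folklore] -/
theorem lt_natAbs_discr_of_satisfiesHeegnerHypothesis_oddPrimesUpTo {K : Type*} [Field K]
    [NumberField K] (hK : IsImaginaryQuadratic K) (B : ℕ)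
    (hH : SatisfiesHeegnerHypothesis
      (∏ q ∈ (Finset.range (max B 5 + 1)).filter (fun q => q.Prime ∧ q ≠ 2), q) K) :
    B < (NumberField.discr K).natAbs := by
  set d := NumberField.discr K with hd
  have hneg : d < 0 := hK.discr_neg
  have hgt : 2 < |d| := NumberField.abs_discr_gt_two (by rw [hK.1]; exact one_lt_two)
  rw [Int.abs_eq_natAbs] at hgt
  have hgt' : 2 < d.natAbs := by exact_mod_cast hgt
  by_contra hle'
  have hle : d.natAbs ≤ B := not_lt.mp hle'
  -- every prime factor of `|d|` is `2`
  have h2pow : ∀ {q : ℕ}, q.Prime → q ∣ d.natAbs → q = 2 := by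
    intro q hq hqd
    by_contra hq2
    have hqB : q ≤ max B 5 :=
      (Nat.le_of_dvd (by omega) hqd).trans (hle.trans (le_max_left B 5))
    have hsplit := Literature.SatisfiesHeegnerHypothesis.not_dvd_discr hK.1 hH hq
      (dvd_oddPrimesUpTo hq hq2 hqB)
    exact hsplit (Int.natCast_dvd.mpr hqd)
  set k := d.natAbs.primeFactorsList.length with hk
  have hpow : d.natAbs = 2 ^ k :=
    Nat.eq_prime_pow_of_unique_prime_dvd (by omega) (fun hq hqd => h2pow hq hqd)
  have hdk : d = -(2 : ℤ) ^ k := by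
    have h1 : ((d.natAbs : ℕ) : ℤ) = -d := Int.ofNat_natAbs_of_nonpos hneg.le
    rw [hpow, Nat.cast_pow, Nat.cast_ofNat] at h1
    linear_combination h1
  have h3 : jacobiSym d 3 = 1 :=
    Literature.SatisfiesHeegnerHypothesis.jacobiSym_discr_eq_one hK.1 hH Nat.prime_three
      (dvd_oddPrimesUpTo Nat.prime_three (by norm_num) ((by norm_num : 3 ≤ 5).trans (le_max_right B 5)))
      (by norm_num)
  have h5 : jacobiSym d 5 = 1 :=
    Literature.SatisfiesHeegnerHypothesis.jacobiSym_discr_eq_one hK.1 hH Nat.prime_five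
      (dvd_oddPrimesUpTo Nat.prime_five (by norm_num) (le_max_right B 5))
      (by norm_num)
  rw [hdk] at h3 h5
  exact (Nat.not_even_iff_odd.mpr (odd_of_jacobiSym_neg_two_pow_three h3))
    (even_of_jacobiSym_neg_two_pow_five h5)

/-! ### §3. The unbounded supply, granted Beckwith–Raum–Richter 2024 Thm 1 -/

/-- **Heegner fields with `|d_K|` beyond any bound, `|d_K| > 4` and class number prime to `ℓ`, for
ODD level** — GRANTED Beckwith–Raum–Richter 2024 Thm 1 (antecedent, the tree's named fact): for every
prime `ℓ`, every odd `N` and every `B` there is an imaginary quadratic `K` with `B < |d_K|`,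
`4 < |d_K|`, every prime factor of `N` split in `K`, and `ℓ ∤ h_K`. Proof: the odd rung
`exists_heegnerField_four_lt_natAbs_discr_not_dvd_classNumber` at the ODD level
`N · ∏_{ℓ' ≤ max B 5, ℓ' odd prime} ℓ'`; the Heegner hypothesis restricts to both factors, and the
second factor gives `B < |d_K|` (§2).
[cite: BeckwithRaumRichter2024, Theorem 1 (IMRN 2024:16 pp. 11582–11583)] -/
theorem exists_heegnerField_lt_natAbs_discr_not_dvd_classNumber
    (h : BeckwithRaumRichter2024.thm1_exists_imaginaryQuadratic_split_not_dvd_classNumber)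
    {ℓ : ℕ} (hℓ : ℓ.Prime) {N : ℕ} (hN : Odd N) (B : ℕ) :
    ∃ (K : Type) (_ : Field K) (_ : NumberField K), IsImaginaryQuadratic K ∧
      B < (NumberField.discr K).natAbs ∧ 4 < (NumberField.discr K).natAbs ∧
      SatisfiesHeegnerHypothesis N K ∧ ¬ ℓ ∣ NumberField.classNumber K := by
  have hodd : Odd (N * (∏ q ∈ (Finset.range (max B 5 + 1)).filter (fun q => q.Prime ∧ q ≠ 2), q)) :=
    hN.mul (odd_oddPrimesUpTo _)
  obtain ⟨K, iF, iN, hK, h4, hH, hcl⟩ :=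
    exists_heegnerField_four_lt_natAbs_discr_not_dvd_classNumber h hℓ hodd
  exact ⟨K, iF, iN, hK,
    lt_natAbs_discr_of_satisfiesHeegnerHypothesis_oddPrimesUpTo hK B (hH.of_dvd (Dvd.intro_left N rfl)),
    h4, hH.of_dvd (Dvd.intro _ rfl), hcl⟩

/-- **KS rung, unbounded (odd conductor, `K′`-form; no twist `L`-value, no biquadratic class
number).** GRANTED Beckwith–Raum–Richter 2024 Thm 1: for every CM curve `W/ℚ` of analytic rank `1`,
every prime `p ≥ 5` of inert-bad type with `N_W` ODD, and every bound `B`, there is an imaginary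
quadratic `K′` with `B < |d_K′|`, `4 < |d_K′|`, the Heegner hypothesis for `N_W` (so the bad prime
`p` splits in `K′`) and `p ∤ h(K′)` — the registered signature of the crux's bridge stub `stub_KS1`
(item stmt-BirchSwinnertonDyer-20198, skeleton 4601c3af) with the twist conjunct
`(W.quadraticTwist d_K′).entireLFunction 1 ≠ 0` REMOVED and the antecedents `BRR24 Thm 1`, `Odd N_W`
ADDED; the curve hypotheses are carried, not used. Not covered: even `N_W`, the twist clause (the
crux's open coupling), `p ∤ h(K_CM·K′)`. [cite: BeckwithRaumRichter2024, Theorem 1] -/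
theorem ksRung_oddConductor_unbounded
    (h : BeckwithRaumRichter2024.thm1_exists_imaginaryQuadratic_split_not_dvd_classNumber) :
    ∀ (W : WeierstrassCurve ℚ) [W.IsElliptic] [W.IsGloballyMinimal] (p : ℕ) [Fact p.Prime]
      [NeZero (W.conductorNorm ℤ)], W.HasCM → W.analyticRank = 1 → 5 ≤ p →
      Rank1Residual.CMInert W p → ¬ Rank1Residual.Good W p → Odd (W.conductorNorm ℤ) →
      ∀ B : ℕ, ∃ (K : Type) (_ : Field K) (_ : NumberField K), IsImaginaryQuadratic K ∧
        B < (NumberField.discr K).natAbs ∧ 4 < (NumberField.discr K).natAbs ∧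
        SatisfiesHeegnerHypothesis (W.conductorNorm ℤ) K ∧ ¬ p ∣ NumberField.classNumber K := by
  intro W _ _ p hp _ _ _ _ _ _ hodd B
  exact exists_heegnerField_lt_natAbs_discr_not_dvd_classNumber h hp.out hodd B

end Summit.BirchSwinnertonDyer.BirchSwinnertonDyer.Theorems.BiquadraticEisensteinDescentHeegnerFieldSupplyOddRungUnbounded
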